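import Summits.MatrixMultiplication.MatrixMultiplication.Theses.LevelGradedCohnUmans

/-!
# `SnLevelDesigns` (crux stmt-MatrixMultiplication-7613, route `LevelGradedCohnUmans`):
# the token space and the three dimension walls (negative-side support, refuter cdisprove seat)

Sorry-free; nothing here asserts a route item positively.  The separation hypothesis `h` of each
wall is the crux's `k`-token separation clause verbatim (inlined).

* `tokenFn c g = ∑_{p : [k]→[n]} c p (g ∘ p)` — the `k`-token test functional; `tokenFn_translate` —
  two-sided translation invariance with the explicit re-indexed table `c' p q = c (b⁻¹ ∘ p) (a ∘ q)`
  (the plumbing `TokenBudget` / `GradedDesignFamily` need); `tokenMap`, `tokenSpace n k` (the test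
  space `T_k` as a submodule of `ℂ^{𝔖ₙ}`), `translate_mem_tokenSpace`.
* `linearIndependent_of_dualPoints` — a family in `T_k` with dual evaluation points is free.
* WALLS `card_X_mul_card_Z_le_finrank` (`Y ≠ ∅`), `card_X_mul_card_Y_le_finrank` (`Z ≠ ∅`),
  `card_Y_mul_card_Z_le_finrank` (`X ≠ ∅`): the separators, resp. their right/left translates, are
  such families; `volume_sq_le_finrank_cube`: `(|X||Y||Z|)² ≤ (dim T_k)³`.
  Route item `TokenWall` = these plus the Schensted count `dim T_k = ∑_{μ₁ ≥ n-k} (f^μ)²` (not here).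
Companion files: `DeadCorners.lean`, `CoveringWall.lean`; census in `Cruxes/SnLevelDesigns/Disproof.lean`.
-/

namespace Summit.MatrixMultiplication.MatrixMultiplication.Theorems.SnLevelDesigns.Negative

open scoped BigOperators

noncomputable section

/-- The `k`-token test functional with coefficient table `c`: `g ↦ ∑_{p : [k] → [n]} c p (g ∘ p)`. -/
def tokenFn {n k : ℕ} (c : (Fin k → Fin n) → (Fin k → Fin n) → ℂ) (g : Equiv.Perm (Fin n)) : ℂ :=
  ∑ p : Fin k → Fin n, c p (⇑g ∘ p)

/-- Two-sided translation invariance of the token space: `g ↦ f(a g b)` is again a `k`-token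
functional, with the re-indexed table `c' p q = c (b⁻¹ ∘ p) (a ∘ q)`. -/
theorem tokenFn_translate {n k : ℕ} (c : (Fin k → Fin n) → (Fin k → Fin n) → ℂ)
    (a b g : Equiv.Perm (Fin n)) :
    tokenFn c (a * g * b) = tokenFn (fun p q => c (⇑b⁻¹ ∘ p) (⇑a ∘ q)) g := by
  unfold tokenFn
  -- reindex `p ↦ b ∘ p` on the right-hand side
  let e : (Fin k → Fin n) ≃ (Fin k → Fin n) := Equiv.arrowCongr (Equiv.refl (Fin k)) b
  symm
  rw [← e.sum_comp]
  refine Finset.sum_congr rfl fun p _ => ?_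
  have h1 : (⇑b⁻¹ ∘ (e p) : Fin k → Fin n) = p := by
    funext i; simp [e, Equiv.arrowCongr_apply, Equiv.Perm.inv_def]
  have h2 : (⇑a ∘ (⇑g ∘ e p) : Fin k → Fin n) = ⇑(a * g * b) ∘ p := by
    funext i; simp [e, Equiv.arrowCongr_apply]
  simp only [h1, h2]

/-- The `k`-token map `c ↦ (g ↦ ∑_p c p (g ∘ p))` as a linear map. -/
def tokenMap (n k : ℕ) : ((Fin k → Fin n) → (Fin k → Fin n) → ℂ) →ₗ[ℂ] (Equiv.Perm (Fin n) → ℂ) where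
  toFun c := tokenFn c
  map_add' c c' := by
    funext g; simp [tokenFn, Finset.sum_add_distrib]
  map_smul' r c := by
    funext g; simp [tokenFn, Finset.mul_sum]

/-- The `k`-token test space `T_k ≤ ℂ^{𝔖ₙ}` (= EFP's `V_k`, = `kCosetSpan n k`). -/
def tokenSpace (n k : ℕ) : Submodule ℂ (Equiv.Perm (Fin n) → ℂ) :=
  LinearMap.range (tokenMap n k)

/-- Token functionals lie in the token space. -/
theorem tokenFn_mem_tokenSpace {n k : ℕ} (c : (Fin k → Fin n) → (Fin k → Fin n) → ℂ) :
    tokenFn c ∈ tokenSpace n k :=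
  ⟨c, rfl⟩

/-- The token space is invariant under two-sided translation. -/
theorem translate_mem_tokenSpace {n k : ℕ} {f : Equiv.Perm (Fin n) → ℂ} (hf : f ∈ tokenSpace n k)
    (a b : Equiv.Perm (Fin n)) : (fun g => f (a * g * b)) ∈ tokenSpace n k := by
  obtain ⟨c, rfl⟩ := hf
  exact ⟨fun p q => c (⇑b⁻¹ ∘ p) (⇑a ∘ q), funext fun g => (tokenFn_translate c a b g).symm⟩

/-- `T_k` is finite-dimensional (a submodule of `ℂ^{𝔖ₙ}`). -/
instance (n k : ℕ) : Module.Finite ℂ (tokenSpace n k) := by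
  unfold tokenSpace; infer_instance

/-- A family in `T_k` with a system of "dual points" is linearly independent. -/
theorem linearIndependent_of_dualPoints {n k : ℕ} {ι : Type*} [Fintype ι]
    (v : ι → tokenSpace n k) (pt : ι → Equiv.Perm (Fin n))
    (hv₁ : ∀ i, (v i : Equiv.Perm (Fin n) → ℂ) (pt i) = 1)
    (hv₀ : ∀ i j, i ≠ j → (v j : Equiv.Perm (Fin n) → ℂ) (pt i) = 0) :
    LinearIndependent ℂ v := by
  rw [Fintype.linearIndependent_iff]
  intro g hg i
  have := congrArg (fun w : tokenSpace n k => (w : Equiv.Perm (Fin n) → ℂ) (pt i)) hg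
  simp only [Submodule.coe_sum, Submodule.coe_smul, Finset.sum_apply, Pi.smul_apply, smul_eq_mul,
    Submodule.coe_zero, Pi.zero_apply] at this
  rw [Finset.sum_eq_single i (fun j _ hji => by rw [hv₀ i j (Ne.symm hji), mul_zero])
    (fun hi => absurd (Finset.mem_univ i) hi), hv₁ i, mul_one] at this
  exact this

/-- Wall `|X|·|Z| ≤ dim T_k` (the separators themselves; `Y ≠ ∅`). -/
theorem card_X_mul_card_Z_le_finrank {n k : ℕ} {X Y Z : Finset (Equiv.Perm (Fin n))}
    (h : ∀ x₀ ∈ X, ∀ z₀ ∈ Z, ∃ c : (Fin k → Fin n) → (Fin k → Fin n) → ℂ, ∀ x ∈ X, ∀ y ∈ Y,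
      ∀ y' ∈ Y, ∀ z ∈ Z, (∑ p : Fin k → Fin n, c p (⇑(x⁻¹ * y * y'⁻¹ * z) ∘ p)) =
        if x = x₀ ∧ y = y' ∧ z = z₀ then 1 else 0) (hY : Y.Nonempty) :
    X.card * Z.card ≤ Module.finrank ℂ (tokenSpace n k) := by
  classical
  obtain ⟨y₁, hy₁⟩ := hY
  choose c hc using h
  let v : X × Z → tokenSpace n k := fun i =>
    ⟨tokenFn (c i.1 i.1.2 i.2 i.2.2), tokenFn_mem_tokenSpace _⟩
  have hli : LinearIndependent ℂ v := by
    refine linearIndependent_of_dualPoints v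
      (fun i => (i.1 : Equiv.Perm (Fin n))⁻¹ * y₁ * y₁⁻¹ * i.2) ?_ ?_
    · rintro ⟨⟨x, hx⟩, ⟨z, hz⟩⟩
      change tokenFn (c x hx z hz) (x⁻¹ * y₁ * y₁⁻¹ * z) = _
      unfold tokenFn
      rw [hc x hx z hz x hx y₁ hy₁ y₁ hy₁ z hz, if_pos ⟨rfl, rfl, rfl⟩]
    · rintro ⟨⟨x, hx⟩, ⟨z, hz⟩⟩ ⟨⟨x₀, hx₀⟩, ⟨z₀, hz₀⟩⟩ hne
      change tokenFn (c x₀ hx₀ z₀ hz₀) (x⁻¹ * y₁ * y₁⁻¹ * z) = _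
      unfold tokenFn
      rw [hc x₀ hx₀ z₀ hz₀ x hx y₁ hy₁ y₁ hy₁ z hz, if_neg]
      rintro ⟨rfl, -, rfl⟩
      exact hne rfl
  have := hli.fintype_card_le_finrank
  rwa [Fintype.card_prod, Fintype.card_coe, Fintype.card_coe] at this

/-- Wall `|X|·|Y| ≤ dim T_k` (right translates of the separators of one column `z₁`). -/
theorem card_X_mul_card_Y_le_finrank {n k : ℕ} {X Y Z : Finset (Equiv.Perm (Fin n))}
    (h : ∀ x₀ ∈ X, ∀ z₀ ∈ Z, ∃ c : (Fin k → Fin n) → (Fin k → Fin n) → ℂ, ∀ x ∈ X, ∀ y ∈ Y,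
      ∀ y' ∈ Y, ∀ z ∈ Z, (∑ p : Fin k → Fin n, c p (⇑(x⁻¹ * y * y'⁻¹ * z) ∘ p)) =
        if x = x₀ ∧ y = y' ∧ z = z₀ then 1 else 0) (hZ : Z.Nonempty) :
    X.card * Y.card ≤ Module.finrank ℂ (tokenSpace n k) := by
  classical
  obtain ⟨z₁, hz₁⟩ := hZ
  choose c hc using h
  let v : X × Y → tokenSpace n k := fun i =>
    ⟨fun w => tokenFn (c i.1 i.1.2 z₁ hz₁) (1 * w * ((i.2 : Equiv.Perm (Fin n))⁻¹ * z₁)),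
      translate_mem_tokenSpace (tokenFn_mem_tokenSpace _) 1 _⟩
  have hli : LinearIndependent ℂ v := by
    refine linearIndependent_of_dualPoints v (fun i => (i.1 : Equiv.Perm (Fin n))⁻¹ * i.2) ?_ ?_
    · rintro ⟨⟨x, hx⟩, ⟨y, hy⟩⟩
      change tokenFn (c x hx z₁ hz₁) (1 * (x⁻¹ * y) * (y⁻¹ * z₁)) = _
      rw [show (1 * (x⁻¹ * y) * (y⁻¹ * z₁)) = x⁻¹ * y * y⁻¹ * z₁ by group]
      unfold tokenFn
      rw [hc x hx z₁ hz₁ x hx y hy y hy z₁ hz₁, if_pos ⟨rfl, rfl, rfl⟩]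
    · rintro ⟨⟨x, hx⟩, ⟨y, hy⟩⟩ ⟨⟨x₀, hx₀⟩, ⟨y', hy'⟩⟩ hne
      change tokenFn (c x₀ hx₀ z₁ hz₁) (1 * (x⁻¹ * y) * (y'⁻¹ * z₁)) = _
      rw [show (1 * (x⁻¹ * y) * (y'⁻¹ * z₁)) = x⁻¹ * y * y'⁻¹ * z₁ by group]
      unfold tokenFn
      rw [hc x₀ hx₀ z₁ hz₁ x hx y hy y' hy' z₁ hz₁, if_neg]
      rintro ⟨rfl, rfl, -⟩
      exact hne rfl
  have := hli.fintype_card_le_finrank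
  rwa [Fintype.card_prod, Fintype.card_coe, Fintype.card_coe] at this

/-- Wall `|Y|·|Z| ≤ dim T_k` (left translates of the separators of one row `x₁`). -/
theorem card_Y_mul_card_Z_le_finrank {n k : ℕ} {X Y Z : Finset (Equiv.Perm (Fin n))}
    (h : ∀ x₀ ∈ X, ∀ z₀ ∈ Z, ∃ c : (Fin k → Fin n) → (Fin k → Fin n) → ℂ, ∀ x ∈ X, ∀ y ∈ Y,
      ∀ y' ∈ Y, ∀ z ∈ Z, (∑ p : Fin k → Fin n, c p (⇑(x⁻¹ * y * y'⁻¹ * z) ∘ p)) =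
        if x = x₀ ∧ y = y' ∧ z = z₀ then 1 else 0) (hX : X.Nonempty) :
    Y.card * Z.card ≤ Module.finrank ℂ (tokenSpace n k) := by
  classical
  obtain ⟨x₁, hx₁⟩ := hX
  choose c hc using h
  let v : Y × Z → tokenSpace n k := fun i =>
    ⟨fun w => tokenFn (c x₁ hx₁ i.2 i.2.2) ((x₁⁻¹ * (i.1 : Equiv.Perm (Fin n))) * w * 1),
      translate_mem_tokenSpace (tokenFn_mem_tokenSpace _) _ 1⟩
  have hli : LinearIndependent ℂ v := by
    refine linearIndependent_of_dualPoints v (fun i => (i.1 : Equiv.Perm (Fin n))⁻¹ * i.2) ?_ ?_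
    · rintro ⟨⟨y, hy⟩, ⟨z, hz⟩⟩
      change tokenFn (c x₁ hx₁ z hz) ((x₁⁻¹ * y) * (y⁻¹ * z) * 1) = _
      rw [show ((x₁⁻¹ * y) * (y⁻¹ * z) * 1) = x₁⁻¹ * y * y⁻¹ * z by group]
      unfold tokenFn
      rw [hc x₁ hx₁ z hz x₁ hx₁ y hy y hy z hz, if_pos ⟨rfl, rfl, rfl⟩]
    · rintro ⟨⟨y', hy'⟩, ⟨z, hz⟩⟩ ⟨⟨y, hy⟩, ⟨z₀, hz₀⟩⟩ hne
      change tokenFn (c x₁ hx₁ z₀ hz₀) ((x₁⁻¹ * y) * (y'⁻¹ * z) * 1) = _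
      rw [show ((x₁⁻¹ * y) * (y'⁻¹ * z) * 1) = x₁⁻¹ * y * y'⁻¹ * z by group]
      unfold tokenFn
      rw [hc x₁ hx₁ z₀ hz₀ x₁ hx₁ y hy y' hy' z hz, if_neg]
      rintro ⟨-, rfl, rfl⟩
      exact hne rfl
  have := hli.fintype_card_le_finrank
  rwa [Fintype.card_prod, Fintype.card_coe, Fintype.card_coe] at this

/-- The three walls combined: `(|X||Y||Z|)² ≤ (dim T_k)³`. -/
theorem volume_sq_le_finrank_cube {n k : ℕ} {X Y Z : Finset (Equiv.Perm (Fin n))}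
    (h : ∀ x₀ ∈ X, ∀ z₀ ∈ Z, ∃ c : (Fin k → Fin n) → (Fin k → Fin n) → ℂ, ∀ x ∈ X, ∀ y ∈ Y,
      ∀ y' ∈ Y, ∀ z ∈ Z, (∑ p : Fin k → Fin n, c p (⇑(x⁻¹ * y * y'⁻¹ * z) ∘ p)) =
        if x = x₀ ∧ y = y' ∧ z = z₀ then 1 else 0) :
    (X.card * Y.card * Z.card) ^ 2 ≤ Module.finrank ℂ (tokenSpace n k) ^ 3 := by
  classical
  rcases X.eq_empty_or_nonempty with hX | hX
  · simp [hX]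
  rcases Y.eq_empty_or_nonempty with hY | hY
  · simp [hY]
  rcases Z.eq_empty_or_nonempty with hZ | hZ
  · simp [hZ]
  have h1 := card_X_mul_card_Y_le_finrank h hZ
  have h2 := card_Y_mul_card_Z_le_finrank h hX
  have h3 := card_X_mul_card_Z_le_finrank h hY
  calc (X.card * Y.card * Z.card) ^ 2 = (X.card * Y.card) * (Y.card * Z.card) * (X.card * Z.card) := by
        ring
    _ ≤ Module.finrank ℂ (tokenSpace n k) * Module.finrank ℂ (tokenSpace n k) *
        Module.finrank ℂ (tokenSpace n k) := by gcongr
    _ = Module.finrank ℂ (tokenSpace n k) ^ 3 := by ring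



end

end Summit.MatrixMultiplication.MatrixMultiplication.Theorems.SnLevelDesigns.Negative
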